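import Mathlib
import Literature.NumberTheory.Sieve.Maynard2016BaseSetCount
import HarnessLib

/-!
# Maynard 2016: `#{n ≤ U/m : (n(mn − 1), P_w) = 1} = (U/m) ∏_{p ≤ w}(1 − ω_m(p)/p) + O(P_w)`

Topic `Literature/NumberTheory/Sieve`. J. Maynard, *Large gaps between primes*, Ann. of Math. (2)
183 (2016), 915–933 = arXiv:1408.5110, §4 display (4.1), §6 displays (6.6), (6.17), (6.30): the
base set of the weights (4.1) has `(U/m) ∏_{p ≤ w}(1 − ω_m(p)/p) + O(P_w + 1)` elements, and
`P_w ≤ (log₃ x)³` (`Maynard2016Growth.Pw_le_log₃_pow`), negligible against `U/m ≥ z (log₂ x)²`.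

PROVED here (no named facts): `density_nonneg`, `density_le_one`,
`abs_card_baseSet_sub_density_le` (error `≤ P_w + 1`) and the packaged
`eventually_abs_card_baseSet_sub_density_le` (error `≤ (log₃ x)³ + 1` for all `m ≥ 1`).

## References

* J. Maynard, *Large gaps between primes*, Ann. of Math. (2) 183 (2016), 915–933; arXiv:1408.5110,
  §4 (4.1), §6 (6.6), (6.17), (6.30). [Maynard2016LargeGaps]
-/

open Filter Finset
open scoped Topology

namespace Literature.NumberTheory.Sieve

namespace Maynard2016

/-- `0 ≤ ∏_{p ≤ w}(1 − ω_m(p)/p)`. [cite: Maynard2016LargeGaps, §6 display (6.17)] -/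
theorem density_nonneg (m x : ℕ) :
    0 ≤ ∏ p ∈ (Finset.Iic ⌊wFun x⌋₊).filter Nat.Prime,
      (1 - ((if p ∣ m then 1 else 2 : ℕ) : ℝ) / p) := by
  rw [← prod_sub_div_Pw_eq]
  exact div_nonneg (prod_sub_nonneg m x) (Nat.cast_nonneg _)

/-- `∏_{p ≤ w}(1 − ω_m(p)/p) ≤ 1`. [cite: Maynard2016LargeGaps, §6 display (6.17)] -/
theorem density_le_one (m x : ℕ) :
    ∏ p ∈ (Finset.Iic ⌊wFun x⌋₊).filter Nat.Prime,
      (1 - ((if p ∣ m then 1 else 2 : ℕ) : ℝ) / p) ≤ 1 := by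
  rw [← prod_sub_div_Pw_eq]
  have hP : (0 : ℝ) < Pw x := by exact_mod_cast primorial_pos _
  rw [div_le_one hP]
  exact prod_sub_le_Pw m x

/-- **The size of the base set, density form.** For `m ≥ 1` and `U ≥ 0`:
`| #{1 ≤ n ≤ ⌊U/m⌋ : (n(mn − 1), P_w) = 1} − (U/m) ∏_{p ≤ w}(1 − ω_m(p)/p) | ≤ P_w + 1`.
[cite: Maynard2016LargeGaps, §6 displays (6.6), (6.17)] -/
theorem abs_card_baseSet_sub_density_le {m : ℕ} (hm : 1 ≤ m) {C_U ε : ℝ} {x : ℕ}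
    (hU : 0 ≤ U C_U ε x) :
    |((baseSet C_U ε x m).card : ℝ) -
        U C_U ε x / m * ∏ p ∈ (Finset.Iic ⌊wFun x⌋₊).filter Nat.Prime,
          (1 - ((if p ∣ m then 1 else 2 : ℕ) : ℝ) / p)| ≤ (Pw x : ℝ) + 1 := by
  set δ := ∏ p ∈ (Finset.Iic ⌊wFun x⌋₊).filter Nat.Prime,
    (1 - ((if p ∣ m then 1 else 2 : ℕ) : ℝ) / p) with hδdef
  set D := ∏ p ∈ (Finset.range (⌊wFun x⌋₊ + 1)).filter Nat.Prime,
    ((p : ℝ) - ((if p ∣ m then 1 else 2 : ℕ) : ℝ)) with hDdef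
  have hδD : D / (Pw x : ℝ) = δ := prod_sub_div_Pw_eq m x
  have h1 := abs_card_baseSet_sub_le hm C_U ε x
  rw [mul_div_assoc, hδD] at h1
  have hDP : D ≤ Pw x := prod_sub_le_Pw m x
  have hδ0 : 0 ≤ δ := density_nonneg m x
  have hδ1 : δ ≤ 1 := density_le_one m x
  have hUm : 0 ≤ U C_U ε x / m := div_nonneg hU (Nat.cast_nonneg _)
  have hfl : |U C_U ε x / m * δ - (⌊U C_U ε x / m⌋₊ : ℝ) * δ| ≤ 1 := by
    rw [← sub_mul, abs_mul, abs_of_nonneg hδ0]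
    have h2 : |U C_U ε x / m - (⌊U C_U ε x / m⌋₊ : ℝ)| ≤ 1 := by
      rw [abs_le]
      constructor
      · linarith [Nat.floor_le hUm]
      · linarith [Nat.lt_floor_add_one (U C_U ε x / m)]
    calc |U C_U ε x / m - (⌊U C_U ε x / m⌋₊ : ℝ)| * δ ≤ 1 * 1 :=
          mul_le_mul h2 hδ1 hδ0 zero_le_one
      _ = 1 := one_mul _
  calc |((baseSet C_U ε x m).card : ℝ) - U C_U ε x / m * δ|
      = |(((baseSet C_U ε x m).card : ℝ) - (⌊U C_U ε x / m⌋₊ : ℝ) * δ) -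
          (U C_U ε x / m * δ - (⌊U C_U ε x / m⌋₊ : ℝ) * δ)| := by ring_nf
    _ ≤ |((baseSet C_U ε x m).card : ℝ) - (⌊U C_U ε x / m⌋₊ : ℝ) * δ| +
          |U C_U ε x / m * δ - (⌊U C_U ε x / m⌋₊ : ℝ) * δ| := abs_sub _ _
    _ ≤ D + 1 := add_le_add h1 hfl
    _ ≤ (Pw x : ℝ) + 1 := by linarith

/-- **Packaged along `x → ∞`** (`0 < C_U`, `ε ≤ 1/2`): for all large `x` and every `m ≥ 1`,
`| #baseSet − (U/m) ∏_{p ≤ w}(1 − ω_m(p)/p) | ≤ (log₃ x)³ + 1`. [cite: Maynard2016LargeGaps, §4 («P_w = o(log₂ x)»), §6 display (6.17)] -/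
theorem eventually_abs_card_baseSet_sub_density_le {C_U ε : ℝ} (hCU : 0 < C_U) (hε : ε ≤ 1 / 2) :
    ∀ᶠ x : ℕ in atTop, ∀ m : ℕ, 1 ≤ m →
      |((baseSet C_U ε x m).card : ℝ) -
          U C_U ε x / m * ∏ p ∈ (Finset.Iic ⌊wFun x⌋₊).filter Nat.Prime,
            (1 - ((if p ∣ m then 1 else 2 : ℕ) : ℝ) / p)| ≤
        Real.log (Real.log (Real.log x)) ^ 3 + 1 := by
  filter_upwards [eventually_wTrick hε, eventually_iteratedLogs, eventually_gt_atTop 0]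
    with x hx hlogs hx0 m hm
  obtain ⟨-, hly, -, -, -, hPw⟩ := hx
  obtain ⟨-, hL₂, -⟩ := hlogs
  have hU : 0 ≤ U C_U ε x := (U_pos hCU hx0 hly (by linarith)).le
  exact (abs_card_baseSet_sub_density_le hm hU).trans (by linarith)

end Maynard2016

end Literature.NumberTheory.Sieve
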